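import Summits.BirchSwinnertonDyer.BirchSwinnertonDyer.Theses.ThetaPartnerAtTwo
import Summits.BirchSwinnertonDyer.BirchSwinnertonDyer.Theorems.ThetaPartnerAtTwoSignedMainConjectureCMTwoRankZeroFlatOfCuspSpan
import Summits.BirchSwinnertonDyer.BirchSwinnertonDyer.Theorems.ResidualThetaTransportAtTwoThetaLayerLambdaCongruenceAtTwoCuspSpanOddLevel
import Summits.BirchSwinnertonDyer.BirchSwinnertonDyer.Theorems.ResidualThetaTransportAtTwoThetaLayerLambdaCongruenceAtTwoCuspSpanRowInductionOdd
import HarnessLib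

/-!
# Skeleton line `cuspspan` v2 (CLOSED — 0 sorries) — crux μ♭ `AnalyticMuFlatCMTwoRankZero` (item stmt-BirchSwinnertonDyer-26470; route
# `ThetaPartnerAtTwo` (TP2), K2 column, binder `hFlat` of `closes`; LEAD prover bsd-tp2-w6 g0, 2026-08-28)

HONEST FRAMING (cell `pub/bsd-wall`, W-ALL row 1). The crux (μ♭)_A says: for every CM curve `A/ℚ` of analytic rank `0`, good
supersingular at `2` with `a₂(A) = 0`, off the unit zone (`2 ∣ #Ш(A)·∏ c_ℓ`), every newform `f` of `A` and every Pollack pair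
`(L⁺, L⁻)` of `f` at `2`, Kobayashi's `L♭ = kobayashiL 1 L⁺ L⁻` has a unit coefficient (`μ(L♭) = 0`) — an instance of
Perrin-Riou's / Pollack's `μ^± = 0` conjecture at `p = 2` (Pollack 2003 Conj. 6.3; Pollack–Weston 2011 Rem. 4.2), in the TREE's
currency (`IsPollackPair`, `ratPlusSymbol`). BSD is NOT proved by any of this; closing this crux closes the binder `hFlat` only —
K2R0P♭ (26471 ⟸ KZ, PUB-HOLD) and the other columns of the route remain.

THE LINE. The tree already reduces the crux BY NAME to the curve-free, level-indexed node (G′)_N of the RTT seats: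
`Theorems.analyticMuFlatNonUnitCMTwo_of_cuspSpan_all` (tp2-p2 g5, file `…SignedMainConjectureCMTwoRankZeroFlatOfCuspSpan`):
«(G′)_N at every odd level `N`» ⟹ ⟨26470's body VERBATIM⟩, through `SignedMuAtTwo.flatAtTwo_of_cuspSpan` (p593268: (G′)_{N_W} ⟹
`2 ∤ L♭` for every Pollack pair at `2` of the newform of ANY globally minimal `W` with `GoodSS W 2`, `a₂ = 0`) and
`exists_isUnit_coeff_of_not_C_two_dvd` (`2 ∤ L ⟺` a unit coefficient in `ℤ₂⟦T⟧`). Here (G′)_N = `SignedMuAtTwo.CuspSpanEvenAtTwo N`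
(`…ResidualThetaTransportAtTwoCuspSpanDefs`, `@[conjecture] def`, unfolded by `Iff.rfl`): every additive `χ : Γ₀(N) → 𝔽₂` that factors
through the weight-2 period functionals and kills every `γ` with lower-right entry `±4^k` (`k ≥ 1`) is `ψ ∘ (d mod N)` with `ψ`
multiplicative on units — dually, the even `2`-power cusp classes `{0 → b/4^k}` span `ker(H₁(X₀(N); 𝔽₂) → Q_N ⊗ 𝔽₂)`. The whole
node «∀ odd `N`, (G′)_N» is route item 27436 `CuspSpanEvenAtTwoOdd` (shared by TP2 and RTT).

v2 (15:15Z): stub₂ is PROVED — landed by name + registered signature as `Theorems.AnalyticMuFlatAtTwo.stub_cuspSpanOddThreeDvd` (TP2 w7) over rtt-p3-w2 g5's `SignedMuAtTwo.Rows.cuspSpanEvenAtTwo_of_not_two_dvd` ((G′)_N at EVERY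
odd level, file `…CuspSpanRowInductionOdd`, p643326, 15:02Z; the shared node item 27436 `CuspSpanEvenAtTwoOdd` CLOSED·proved
15:07:23Z by p643713) — so the skeleton has NO `sorry`, the composition is a complete kernel proof of the crux with the standard
axioms, and this file is landed as `Theorems/ThetaPartnerAtTwoAnalyticMuFlatCMTwoRankZero.lean` (`--workitem 26470`) with the
closer `Theorems.AnalyticMuFlatCMTwoRankZero_proof`. TP2 w7's by-name glue (`Theorems.AnalyticMuFlatAtTwo.*`, p643522) gives the
same implication from the item 27436 by name. What is proved, precisely: μ(L♭_f) = 0 at p = 2 in the tree's Ω⁺_f / Mazur–Tate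
normalisation (`IsPollackPair`, `ratPlusSymbol`) for the newform of every rank-0 CM curve good supersingular at 2 with a₂ = 0 off
the unit zone — in fact (RTT, `SignedMuAtTwo.flatAtTwo_of_conductor_odd`) for every curve good supersingular at 2 with a₂ = 0.
BSD is NOT proved by this; K2R0P♭ 26471 ⟸ KZ (PUB-HOLD) remains the K2 column's open input.

STUBS — cut at the tree's frontier at registration (v1, 2026-08-28T15:05Z):
* `stub_cuspSpanOddPrimeToThree` — (G′)_N at every odd `N` with `3 ∤ N`: **PROVED** in the tree (rtt-p3-w4 g2,
  `SignedMuAtTwo.cuspSpanEvenAtTwo_odd_of_not_three_dvd`, p642344: strong row induction from `B₁` + the `F`-character theorem + CRT);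
  restated here by name, no `sorry`. Reading for the crux: FLAT is thereby UNCONDITIONAL (standard axioms, no named-fact binder)
  for every habitat curve whose (odd) conductor is prime to `3` — the CM families `−11, −19, −43, −67, −163` twisted prime to `3`.
* `stub_cuspSpanOddThreeDvd` — (G′)_N at every odd `N` with `3 ∣ N`: the only `sorry` of v1, PROVED in v2 by name
  (`SignedMuAtTwo.Rows.cuspSpanEvenAtTwo_of_not_two_dvd`, p643326). It contains the declared open tail of the
  crux (`j = 0`, `ρ̄ = Ind_{ℚ(√−3)} χ_m`, levels `27·m²`, `243·m²`, …) and the `3`-twisted members of the other CM families. OWNED at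
  registration time: rtt-p3-w2 g5's file (B) `…CuspSpanRowInductionOdd` (dev file rc 0 / 0 sorries at every odd `N`, announced
  14:54:41Z: `chi_eq_zero_row_step'` without `3 ∤ N` over the landed `ℓ = 3` CRT variant p642718, then `cuspSpanEvenAtTwo_oddLevel`);
  backup rtt-p3-w4 g2's parked rc-0 twins; contingency owner TP2 w7.
COMPOSITION `AnalyticMuFlatCMTwoRankZero_of` (kernel, no `sorry` of its own): `analyticMuFlatNonUnitCMTwo_of_cuspSpan_all` applied to
the by-cases union of the two stubs (`2 ∤ N_A` is supplied inside that theorem by good reduction at `2`).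

References: [Pollack2003] Conj. 6.3, Prop. 6.18; [Kobayashi2003] Thm. 1.2, (3.6); [PollackWeston2011MT] §3.1, Rem. 4.2;
[MazurTateTeitelbaum1986Invent] §I.8, §I.13; [Manin1972] §1.5; [Mazur1977] §II.11; arXiv:2409.18021 Rem. 1.2.
-/

set_option autoImplicit false
-- the Cruxes namespace of this sub repeats the summit name by design (D-0017 nested layout)
set_option linter.dupNamespace false

noncomputable section

open CongruenceSubgroup WeierstrassCurve Literature.NumberTheory.EllipticCurves
  Literature.NumberTheory.EllipticCurves.ModularForms Literature.NumberTheory.EllipticCurves.Rank1Residual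
  Summit.BirchSwinnertonDyer.Rank1Residual.Supersingular

namespace Summit.BirchSwinnertonDyer.BirchSwinnertonDyer.Cruxes.AnalyticMuFlatCMTwoRankZero.CuspSpan

/-- **Stub 1 `stub_cuspSpanOddPrimeToThree` — (G′)_N at every odd level prime to `3` — PROVED** (tree theorem
`SignedMuAtTwo.cuspSpanEvenAtTwo_odd_of_not_three_dvd`, rtt-p3-w4 g2, p642344; restated by name so that the registered stub list
shows the frontier). [cite: Pollack2003, Conj. 6.3] [cite: Manin1972, §1.5] -/
theorem stub_cuspSpanOddPrimeToThree :
    ∀ (N : ℕ) [NeZero N], ¬ 2 ∣ N → ¬ 3 ∣ N →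
      Summit.BirchSwinnertonDyer.BirchSwinnertonDyer.Theorems.SignedMuAtTwo.CuspSpanEvenAtTwo N :=
  fun _ _ h2 h3 ↦
    Summit.BirchSwinnertonDyer.BirchSwinnertonDyer.Theorems.SignedMuAtTwo.cuspSpanEvenAtTwo_odd_of_not_three_dvd
      (Nat.not_even_iff_odd.mp fun he ↦ h2 (even_iff_two_dvd.mp he)) h3

-- Stub 2 `stub_cuspSpanOddThreeDvd` ((G′)_N at every odd level divisible by `3` — the ℚ(√−3)/`3`-twisted tail: levels `27·m²`,
-- `243·m²`, `9·121·m²`, …; the only `sorry` of v1) is LANDED by name + registered signature as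
-- `Theorems.AnalyticMuFlatAtTwo.stub_cuspSpanOddThreeDvd` (TP2 w7, file `…AnalyticMuFlatCMTwoRankZeroStubCuspSpanOddThreeDvd`,
-- `--supports 26470`), a one-liner over rtt-p3-w2 g5's `SignedMuAtTwo.Rows.cuspSpanEvenAtTwo_of_not_two_dvd` (p643326: (G′)_N at
-- EVERY odd level — row-induction step `chi_eq_zero_row_step'` without `3 ∤ N` over the `ℓ = 3` CRT variant p642718, all odd rows,
-- parity assembly). Not restated here (dedup): the composition below calls its one-line BODY
-- `SignedMuAtTwo.Rows.cuspSpanEvenAtTwo_of_not_two_dvd N h2` in the `3 ∣ N` branch (the same term as p644171).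

/-- **COMPOSITION** (kernel-checked, no `sorry` of its own): the crux `AnalyticMuFlatCMTwoRankZero` BY NAME from the two stubs,
through `Theorems.analyticMuFlatNonUnitCMTwo_of_cuspSpan_all` ((G′)_N at every odd level ⟹ the crux body verbatim; the level
`N_A` is odd by good reduction at `2`). [cite: Pollack2003, Prop. 6.18 and Conj. 6.3] [cite: Kobayashi2003, (3.6) (p. 7)] -/
theorem AnalyticMuFlatCMTwoRankZero_of :
    Summit.BirchSwinnertonDyer.BirchSwinnertonDyer.Theses.ThetaPartnerAtTwo.AnalyticMuFlatCMTwoRankZero :=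
  Summit.BirchSwinnertonDyer.BirchSwinnertonDyer.Theorems.analyticMuFlatNonUnitCMTwo_of_cuspSpan_all
    fun N _ h2 ↦
      (Summit.BirchSwinnertonDyer.BirchSwinnertonDyer.Theorems.SignedMuAtTwo.cuspSpanEvenAtTwo_iff N).mp
        (if h3 : 3 ∣ N then
          -- = `Theorems.AnalyticMuFlatAtTwo.stub_cuspSpanOddThreeDvd N h2 h3` (registered stub₂, landed p644171), by its body:
          Summit.BirchSwinnertonDyer.BirchSwinnertonDyer.Theorems.SignedMuAtTwo.Rows.cuspSpanEvenAtTwo_of_not_two_dvd N h2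
          else stub_cuspSpanOddPrimeToThree N h2 h3)

end Summit.BirchSwinnertonDyer.BirchSwinnertonDyer.Cruxes.AnalyticMuFlatCMTwoRankZero.CuspSpan

namespace Summit.BirchSwinnertonDyer.BirchSwinnertonDyer.Theorems

/-- **CLOSER of crux μ♭ (item stmt-BirchSwinnertonDyer-26470).** `AnalyticMuFlatCMTwoRankZero` holds: for every CM curve `A/ℚ`
of analytic rank `0`, good supersingular at `2` with `a₂(A) = 0`, off the unit zone, every newform `f` of `A` and every Pollack
pair `(L⁺, L⁻)` of `f` at `2`, Kobayashi's `L♭ = kobayashiL 1 L⁺ L⁻` has a unit coefficient — μ(L♭) = 0 at `p = 2` in the tree's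
Mazur–Tate / `Ω⁺_f` normalisation. Proof = the completed skeleton line `cuspspan` (LEAD bsd-tp2-w6): the crux ⟸ (G′)_N at every
odd level (`Theorems.analyticMuFlatNonUnitCMTwo_of_cuspSpan_all`, tp2-p2 g5) and (G′)_N at every odd level is the RTT cell's theorem
(`SignedMuAtTwo.cuspSpanEvenAtTwo_odd_of_not_three_dvd`, rtt-p3-w4 g2; `SignedMuAtTwo.Rows.cuspSpanEvenAtTwo_of_not_two_dvd`,
rtt-p3-w2 g5). Standard axioms; no named-fact binder. BSD is NOT proved by this.
[cite: Pollack2003, Conj. 6.3 and Prop. 6.18] [cite: Kobayashi2003, Thm. 1.2 and (3.6)] [cite: PollackWeston2011MT, §3.1 and Rem. 4.2] -/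
theorem AnalyticMuFlatCMTwoRankZero_proof :
    Summit.BirchSwinnertonDyer.BirchSwinnertonDyer.Theses.ThetaPartnerAtTwo.AnalyticMuFlatCMTwoRankZero :=
  Summit.BirchSwinnertonDyer.BirchSwinnertonDyer.Cruxes.AnalyticMuFlatCMTwoRankZero.CuspSpan.AnalyticMuFlatCMTwoRankZero_of

end Summit.BirchSwinnertonDyer.BirchSwinnertonDyer.Theorems

end
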